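/-
Copyright: statement-level skeleton of a published paper (lit-balaban cell, Phase-2 proof seat p13, gen 13). No proof
claims beyond what the kernel checks below.
-/
import Literature.MathematicalPhysics.QuantumFieldTheory.BalabanImbrieJaffe1984to88.BIJ88CumulantRegrouping5133
import Literature.MathematicalPhysics.QuantumFieldTheory.BalabanImbrieJaffe1984to88.BIJ88WalkFormOrderOne5133
import Literature.MathematicalPhysics.QuantumFieldTheory.BalabanImbrieJaffe1984to88.BIJ88TruncationConnected306
import Literature.Probability.LatticeModels.UrsellColourings
import Literature.Probability.LatticeModels.CumulantRecursion

/-!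
# `BalabanImbrieJaffe1984to88.BIJ88TruncationConnected5133` — T. Bałaban, J. Imbrie, A. Jaffe, *Effective action and
cluster properties of the abelian Higgs model*, Commun. Math. Phys. **114** (1988) 257–315 [BalabanImbrieJaffe1988],
§5.13 p. 305–306 [PDF 49–50], the road from the bracket form of `∂/∂s_Γ⟨Πf(□_i)⟩` to the walk form (5.13.3):
**"We integrate by parts all fields appearing in this formula. Each Φ contracts through a C_s to another Φ, to an
f(□_i) or to ℱ. If a closed loop forms, or if a train of covariances beginning and ending in ℱ forms, then the term
disappears with truncation."** — APPLIED TO THE ACTUAL OBJECTS OF (5.13.3): the joint truncations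
`⟨[V_{B₁};]⋯[V_{B_k};]H⟩_s` of the block vertices `V_B` (`B ∈ σ`, `σ` a partition of `Γ` into blocks of ≤ 2 cubes) and
the observable `H` that make up `∂Γ⟨H⟩(s)` (`BIJ88CumulantRegrouping5133.dexp_eq_sum_smallParts`, the corrected bracket
form, G-C2-24).

Each block vertex is a quadratic form, `V_B(s,Φ) = ΦᵀM_B(s)Φ = Σ_x ⟨Φ,e_x⟩⟨Φ,M_B(s)_x⟩` (`bmat`, `bvert_eq_sum_bmat`): a
sum over a SITE `x` (a *colouring* of the cluster `B`) of TWO-LEG monomials (legs `⟨B,0⟩ ↦ e_x`, `⟨B,1⟩ ↦ M_B(s)_x`, the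
type `Leg`).  Hence (multilinearity of truncation in the clusters, `LatticeModels.ursellOf_piFinset`; complete
contraction and truncation = connected diagrams, `BIJ88TruncationConnected306.ursellOf_gmoment`):

  `⟨[V_{B₁};]⋯[V_{B_k};]H⟩_s = Σ_{z : σ → sites} Σ_{g connected two-leg diagram on σ ∪ {H}} dval_z(g)`   (`ursell_fmoment_eq_sum_connected`)

and, summed over `σ ∈ smallParts Γ` with the sign `(−1)^{|σ|}`, `∂Γ⟨H⟩(s)` itself (`dexp_eq_sum_connected`): every
field of every vertex is contracted — to another field (weight `⟨C_s v, v'⟩`), to ℱ (`⟨C_s v, ℱ⟩`) or into `H`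
(`⟨∂_{C_sv_D}H⟩_s`) — and only the diagrams in which every vertex is connected to `H` survive: no closed loops, no
ℱ–ℱ trains.  The resummation of the surviving connected two-leg diagrams into the trains
`⟨δ/δΦ, C_s□Δ□C_s⋯(½δ/δΦ + ℱ)⟩` of (5.13.3) (each vertex has exactly two legs, so the component of `H` is a union of
chains) is NOT done in this file.

statement-level skeleton of published theorems with citation tags; proofs where landed; nothing here is a claim
about the Yang–Mills mass gap

PDF held: `paper:balaban1988-cmp114-bij-abelian-higgs-effective-action` (journal page = PDF page + 256).

CITATION HEADER (lean-in-tree rule).  lit-balaban cell (HOME `run/shared/lean/pub/lit-balaban/`), Phase 2, seat p13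
gen 13; row **C2.Eq5.13.3-5.13.4** of `HOME/lit-balaban-r16/ROWS-C2-part2.md` (owner r16, referee ref-5), second clause
of the flip condition.  USED BY NAME, nothing restated: p13 g12 `BIJ88CumulantRegrouping5133.{fmoment, liftFam,
fmoment_insert_none, fmoment_liftFam, fmoment_empty, dexp_eq_sum_smallParts}`, `BIJ88PairingAllOrders5133.{bvert,
smallParts}`, `BIJ88WalkFormOrderOne5133.{pairMat, blockPair_eq_sum}`, `BIJ88SecondOrder5133.{num, Dfun}`,
`BIJ88DirichletForms305.{interpForm, interpForm_posDef}`, `BIJ88IntegrationByParts305.integrable_fieldProd_bdd_tilt`,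
`BIJ88SDerivative305.integral_weight_mul_source_pos`; p13 g13 `BIJ88TruncationConnected306.{gexp, gobs, gmoment, gw, gω,
ursellOf_gmoment}`, `Literature.Probability.LatticeModels.{LegDiagram.*, colours, mem_piFinset_colours,
ursellOf_piFinset}`; `Literature.Probability.LatticeModels.ursellOf_map` (CumulantRecursion).

## What is proved (0 `sorry`, standard axioms, no new `Prop` facts)

* §1 `Leg` (two legs per block; `Fintype`, an arbitrary `LinearOrder` — the order only fixes the order of the iterated
  derivative `∂_{Cv_D}H`), `bmat` (the matrix of a block vertex), `qsum`, **`bvert_eq_sum_bmat`** (`V_B = Σ_x⟨Φ,e_x⟩⟨Φ,M_{B,x}⟩`),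
  `lvec` (the leg vectors of a colouring), `prod_legs_lvec`, **`sum_piFinset_prod_legs`** (`Σ_z Π_legs = Π_B V_B`);
* §2 `optBlock` (blocks ↦ label blocks), `map_optBlock_insertNone`, `fmoment_map_optBlock` (the block-family moments as
  normalized expectations), **`fmoment_eq_sum_gmoment`** (= colour sums of two-leg moments);
* §3 **`ursell_fmoment_eq_sum_connected`**, **`dexp_eq_sum_connected`**.
HONEST SCOPE.  Finite dimension, real fields, `s ∈ [0,1]^I`, `H` in a class `𝒞 ⊆ C¹_b` closed under directional
derivatives; the trains/walks of (5.13.3) are NOT identified here.  NOT summit progress; NOT continuum; NOT Clay.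
-/

noncomputable section

namespace Literature.MathematicalPhysics.QuantumFieldTheory.BalabanImbrieJaffe1984to88.BIJ88TruncationConnected5133

open MeasureTheory Matrix Finset
open scoped BigOperators
open Literature.Probability.LatticeModels (ursellOf ursellOf_map colours mem_piFinset_colours ursellOf_piFinset)
open Literature.Probability.LatticeModels.LegDiagram (legs mem_legs diags dval IsConn)
open Literature.MathematicalPhysics.QuantumFieldTheory.Balaban1983to89
open B2Eq228Conditioning (weight source)
open BIJ88DirichletForms305 (interpForm interpForm_posDef)
open BIJ88IntegrationByParts305 (integrable_fieldProd_bdd_tilt)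
open BIJ88SDerivative305 (integral_weight_mul_source_pos)
open BIJ88SecondOrder5133 (num Dfun)
open BIJ88PairingAllOrders5133 (smallParts bvert)
open BIJ88WalkFormOrderOne5133 (pairMat blockPair_eq_sum)
open BIJ88CumulantAllOrders5133 (dexp)
open BIJ88CumulantRegrouping5133 (liftFam fmoment fmoment_insert_none fmoment_liftFam fmoment_empty
  dexp_eq_sum_smallParts)
open BIJ88TruncationConnected306 (gexp gobs gmoment gw gω ursellOf_gmoment)

/-! ## §1  Two legs per block; the block vertices as sums of two-leg monomials -/

/-- A **leg** of a block vertex: the block `B` and the side (`false` ↦ the field `⟨Φ,e_x⟩`, `true` ↦ the field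
`⟨Φ,M_{B,x}⟩`). [cite: BalabanImbrieJaffe1988, §5.13 p.305] -/
structure Leg (I : Type) where
  /-- the block the leg belongs to -/
  blk : Finset I
  /-- which of the two fields of the vertex -/
  side : Bool

section Legs

variable {I : Type} [Fintype I] [DecidableEq I]

/-- [folklore] -/
def legEquiv : Leg I ≃ Finset I × Bool where
  toFun l := (l.blk, l.side)
  invFun p := ⟨p.1, p.2⟩
  left_inv l := by cases l; rfl
  right_inv p := by cases p; rfl

/-- [folklore] -/
instance instFintypeLeg : Fintype (Leg I) := Fintype.ofEquiv _ (legEquiv (I := I)).symm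

/-- An (arbitrary) linear order of the legs; it only fixes the order in which the iterated derivatives `∂_{Cv_D}H`
are taken. [folklore] -/
instance instLinearOrderLeg : LinearOrder (Leg I) :=
  let e : Leg I ≃ Fin (Fintype.card (Leg I)) := Fintype.equivFin (Leg I)
  LinearOrder.lift' e e.injective

/-- The legs of a vertex family are the legs of its blocks. [cite: BalabanImbrieJaffe1988, §5.13 p.305] -/
theorem mem_legs_iff (P : Finset (Option (Finset I))) (l : Leg I) :
    l ∈ legs Leg.blk P ↔ l.blk ∈ eraseNone P := by
  rw [mem_legs, mem_eraseNone]

end Legs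

section Vertices

variable {α I : Type} [Fintype α] [DecidableEq α] [Fintype I] [DecidableEq I] (blk : α → I) (Δ : Matrix α α ℝ)

/-- A quadratic form written on its first index: `Σ_x ⟨Φ,e_x⟩⟨Φ,M_x⟩` (two linear fields per site).
[cite: BalabanImbrieJaffe1988, §5.13 p.305] -/
def qsum (M : Matrix α α ℝ) (φ : α → ℝ) : ℝ := ∑ x, (φ ⬝ᵥ Pi.single x 1) * (φ ⬝ᵥ fun y => M x y)

/-- The double-sum form `Σ_x Σ_y M_{xy} Φ_xΦ_y`. [cite: BalabanImbrieJaffe1988, §5.13 p.305] -/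
theorem qsum_eq (M : Matrix α α ℝ) (φ : α → ℝ) : qsum M φ = ∑ x, ∑ y, M x y * (φ x * φ y) := by
  refine sum_congr rfl fun x _ => ?_
  rw [dotProduct_single_one, dotProduct, mul_sum]
  exact sum_congr rfl fun y _ => by ring

/-- [folklore] -/
private theorem qsum_sum {κ : Type} (T : Finset κ) (M : κ → Matrix α α ℝ) (φ : α → ℝ) :
    qsum (∑ k ∈ T, M k) φ = ∑ k ∈ T, qsum (M k) φ := by
  simp only [qsum_eq, Matrix.sum_apply, sum_mul]
  exact (sum_congr rfl fun x _ => Finset.sum_comm).trans Finset.sum_comm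

/-- [folklore] -/
private theorem qsum_smul (c : ℝ) (M : Matrix α α ℝ) (φ : α → ℝ) : qsum (c • M) φ = c * qsum M φ := by
  simp only [qsum_eq, Matrix.smul_apply, smul_eq_mul, mul_sum]
  exact sum_congr rfl fun x _ => sum_congr rfl fun y _ => by ring

omit [Fintype I] in
/-- `⟨□_iΦ,Δ□_lΦ⟩ = Σ_x ⟨Φ,e_x⟩⟨Φ,(M^{il})_x⟩`. [cite: BalabanImbrieJaffe1988, §5.13 p.305] -/
theorem blockPair_eq_qsum (φ : α → ℝ) (i l : I) :
    BIJ88DirichletDeriv305.blockPair blk Δ φ i l = qsum (pairMat blk Δ i l) φ := by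
  rw [blockPair_eq_sum, qsum_eq]
  simp only [dotProduct_single_one]

/-- **The matrix of a block vertex**: `M_{{i}}(s) = Σ_{l≠i}s_l M^{il}` (`V_{{i}} = D_i`), `M_{{i,l}} = ½(M^{il} + M^{li})`
(`V_{{i,l}} = ⟨□_iΦ,Δ□_lΦ⟩`, symmetrized as in `bvert`). [cite: BalabanImbrieJaffe1988, §5.13 p.305] -/
def bmat (s : I → ℝ) (B : Finset I) : Matrix α α ℝ :=
  if B.card = 1 then ∑ i ∈ B, ∑ l ∈ univ.erase i, s l • pairMat blk Δ i l
  else ∑ i ∈ B, ∑ l ∈ B.erase i, (1/2 : ℝ) • pairMat blk Δ i l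

/-- **A block vertex is a sum over a site of two-leg monomials**: `V_B(s,Φ) = Σ_x ⟨Φ,e_x⟩⟨Φ,M_B(s)_x⟩`.
[cite: BalabanImbrieJaffe1988, §5.13 p.305] -/
theorem bvert_eq_sum_bmat (s : I → ℝ) (B : Finset I) (φ : α → ℝ) :
    bvert blk Δ s B φ = qsum (bmat blk Δ s B) φ := by
  rw [bvert, bmat]
  split_ifs with h
  · rw [qsum_sum]
    refine sum_congr rfl fun i _ => ?_
    rw [Dfun, qsum_sum]
    exact sum_congr rfl fun l _ => by rw [qsum_smul, blockPair_eq_qsum]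
  · rw [qsum_sum, mul_sum]
    refine sum_congr rfl fun i _ => ?_
    rw [qsum_sum, mul_sum]
    exact sum_congr rfl fun l _ => by rw [qsum_smul, blockPair_eq_qsum]

/-- **The leg vectors of a colouring** `z : blocks → sites`: the leg `⟨B,false⟩` carries `e_{z_B}`, the leg `⟨B,true⟩`
carries the row `M_B(s)_{z_B}`. [cite: BalabanImbrieJaffe1988, §5.13 p.305] -/
def lvec (s : I → ℝ) (z : Finset I → α) (l : Leg I) : α → ℝ :=
  if l.side = true then (fun y => bmat blk Δ s l.blk (z l.blk) y) else Pi.single (z l.blk) 1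

/-- The product of the fields of the legs of a family, for a colouring. [cite: BalabanImbrieJaffe1988, §5.13 p.305] -/
theorem prod_legs_lvec (s : I → ℝ) (z : Finset I → α) (P : Finset (Option (Finset I))) (φ : α → ℝ) :
    ∏ l ∈ legs Leg.blk P, φ ⬝ᵥ lvec blk Δ s z l
      = ∏ B ∈ eraseNone P, (φ ⬝ᵥ Pi.single (z B) 1) * (φ ⬝ᵥ fun y => bmat blk Δ s B (z B) y) := by
  have h1 : ∏ l ∈ legs Leg.blk P, φ ⬝ᵥ lvec blk Δ s z l
      = ∏ p ∈ eraseNone P ×ˢ (univ : Finset Bool),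
          φ ⬝ᵥ (if p.2 = true then (fun y => bmat blk Δ s p.1 (z p.1) y) else Pi.single (z p.1) 1) := by
    refine Finset.prod_equiv legEquiv (fun l => ?_) (fun l _ => rfl)
    rw [mem_legs_iff, mem_product]
    simp [legEquiv]
  rw [h1, prod_product]
  refine prod_congr rfl fun B _ => ?_
  rw [Fintype.prod_bool]
  simp only [if_true, Bool.false_eq_true, if_false]
  ring

/-- **Summing the two-leg monomials over the colourings gives back the block vertices**:
`Σ_{z ∈ colourings of P} Π_{l ∈ legs P} ⟨Φ,v_z(l)⟩ = Π_{B∈P} V_B(s,Φ)`. [cite: BalabanImbrieJaffe1988, §5.13 p.305] -/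
theorem sum_piFinset_prod_legs (s : I → ℝ) (z₀ : Finset I → α) (P : Finset (Option (Finset I))) (φ : α → ℝ) :
    ∑ z ∈ Fintype.piFinset (colours (fun _ => (univ : Finset α)) z₀ P), ∏ l ∈ legs Leg.blk P, φ ⬝ᵥ lvec blk Δ s z l
      = ∏ B ∈ eraseNone P, bvert blk Δ s B φ := by
  have hfilt : (univ : Finset (Finset I)).filter (fun B => some B ∈ P) = eraseNone P := by
    ext B
    rw [mem_filter, mem_eraseNone]
    simp
  -- the summand of a colouring as a product over all blocks
  set F : Finset I → α → ℝ := fun B a =>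
    if some B ∈ P then (φ ⬝ᵥ Pi.single a 1) * (φ ⬝ᵥ fun y => bmat blk Δ s B a y) else 1 with hF
  have hL : ∀ z : Finset I → α, ∏ l ∈ legs Leg.blk P, φ ⬝ᵥ lvec blk Δ s z l = ∏ B, F B (z B) := by
    intro z
    rw [prod_legs_lvec, ← hfilt, prod_filter]
  have hR : ∏ B ∈ eraseNone P, bvert blk Δ s B φ
      = ∏ B, ∑ a ∈ colours (fun _ => (univ : Finset α)) z₀ P B, F B a := by
    rw [← hfilt, prod_filter]
    refine prod_congr rfl fun B _ => ?_
    by_cases hB : some B ∈ P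
    · rw [if_pos hB, colours, if_pos hB, bvert_eq_sum_bmat, qsum]
      exact sum_congr rfl fun a _ => by simp only [hF, if_pos hB]
    · rw [if_neg hB, colours, if_neg hB, sum_singleton]
      simp only [hF, if_neg hB]
  simp_rw [hL]
  rw [hR, Finset.prod_univ_sum]

end Vertices

/-! ## §2  The block-family moments as colour sums of two-leg moments -/

section OptBlock

variable {I : Type} [DecidableEq I]

/-- Blocks as label blocks: `none ↦ {none}` (the observable), `B ↦ B.map some`. [cite: BalabanImbrieJaffe1988, §5.13 p.305] -/
def optBlock : Option (Finset I) ↪ Finset (Option I) where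
  toFun o := o.elim {none} fun B => B.map Function.Embedding.some
  inj' := by
    intro a b h
    cases a with
    | none =>
      cases b with
      | none => rfl
      | some B =>
        exfalso
        have h' : (none : Option I) ∈ (B.map Function.Embedding.some : Finset (Option I)) := by
          rw [← show ({none} : Finset (Option I)) = B.map Function.Embedding.some from h]
          exact mem_singleton_self _
        simp at h'
    | some A =>
      cases b with
      | none =>
        exfalso
        have h' : (none : Option I) ∈ (A.map Function.Embedding.some : Finset (Option I)) := by
          rw [show (A.map Function.Embedding.some : Finset (Option I)) = {none} from h]
          exact mem_singleton_self _
        simp at h'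
      | some B =>
        have h' : A.map Function.Embedding.some = B.map Function.Embedding.some := h
        rw [(map_injective Function.Embedding.some) h']

omit [DecidableEq I] in
/-- [folklore] -/
@[simp] private theorem optBlock_none : (optBlock : Option (Finset I) ↪ Finset (Option I)) none = {none} := rfl

omit [DecidableEq I] in
/-- [folklore] -/
@[simp] private theorem optBlock_some (B : Finset I) :
    (optBlock : Option (Finset I) ↪ Finset (Option I)) (some B) = B.map Function.Embedding.some := rfl

omit [DecidableEq I] in
/-- [cite: BalabanImbrieJaffe1988, §5.13 p.305] -/
theorem map_some_map_optBlock (T : Finset (Finset I)) :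
    (T.map Function.Embedding.some).map optBlock = liftFam T := by
  rw [liftFam, Finset.map_map]
  congr 1

/-- `(insertNone T).map optBlock = {none} ∪ liftFam T`. [cite: BalabanImbrieJaffe1988, §5.13 p.305] -/
theorem map_optBlock_insertNone (T : Finset (Finset I)) :
    (insertNone T).map optBlock = insert {none} (liftFam T) := by
  ext X
  simp only [mem_map, mem_insert, liftFam, RelEmbedding.coe_toEmbedding, mapEmbedding_apply]
  constructor
  · rintro ⟨o, ho, rfl⟩
    cases o with
    | none => exact Or.inl (optBlock_none)
    | some B => exact Or.inr ⟨B, some_mem_insertNone.1 ho, (optBlock_some B).symm⟩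
  · rintro (rfl | ⟨B, hB, rfl⟩)
    · exact ⟨none, none_mem_insertNone, optBlock_none⟩
    · exact ⟨some B, some_mem_insertNone.2 hB, optBlock_some B⟩

end OptBlock

section Moments

variable {α I : Type} [Fintype α] [DecidableEq α] [Fintype I] [DecidableEq I] (blk : α → I) (Δ : Matrix α α ℝ)

variable {Δ} (hΔ : Δ.PosDef) {s : I → ℝ} (hs : ∀ l, 0 ≤ s l ∧ s l ≤ 1) (f : α → ℝ) (H : (α → ℝ) → ℝ)

/-- The observable of a vertex family: `H` if `none ∈ P`, else `1`. [cite: BalabanImbrieJaffe1988, §5.13 p.305] -/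
def pobs (P : Finset (Option (Finset I))) (φ : α → ℝ) : ℝ := if none ∈ P then H φ else 1

/-- `num(…)(s)` is the numerator of the normalized expectation for `A = Δ_s`. [folklore] -/
private theorem gexp_interpForm (G : (α → ℝ) → ℝ) :
    gexp (interpForm blk Δ s) f G = num blk Δ f G s / num blk Δ f (fun _ => 1) s := by
  rw [gexp, num, num]
  congr 1
  exact integral_congr_ae (Filter.Eventually.of_forall fun φ => by simp)

include hΔ hs in
/-- **The block-family moments are normalized expectations**: for every family `P` of blocks (with or without the
observable), `fmoment s (P.map optBlock) = ⟨Π_{B∈P} V_B · H^{[none∈P]}⟩_s`. [cite: BalabanImbrieJaffe1988, §5.13 p.305] -/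
theorem fmoment_map_optBlock (P : Finset (Option (Finset I))) :
    fmoment blk Δ f H s (P.map optBlock)
      = gexp (interpForm blk Δ s) f (fun φ => (∏ B ∈ eraseNone P, bvert blk Δ s B φ) * pobs H P φ) := by
  rw [gexp_interpForm]
  by_cases hn : none ∈ P
  · have hP : P = insertNone (eraseNone P) := by
      rw [insertNone_eraseNone]
      exact (insert_eq_of_mem hn).symm
    conv_lhs => rw [hP, map_optBlock_insertNone, fmoment_insert_none]
    congr 2
    funext φ
    rw [pobs, if_pos hn]
  · by_cases hP0 : P = ∅
    · subst hP0
      rw [map_empty, fmoment_empty]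
      have hZ : num blk Δ f (fun _ => (1:ℝ)) s ≠ 0 := by
        rw [num]
        have := integral_weight_mul_source_pos (interpForm_posDef blk hΔ hs) f
        simp only [one_mul]
        exact this.ne'
      rw [eq_div_iff hZ, one_mul]
      congr 1
      funext φ
      simp [pobs]
    · have hP : P = (eraseNone P).map Function.Embedding.some := by rw [map_some_eraseNone, erase_eq_of_notMem hn]
      have hne : eraseNone P ≠ ∅ := by
        intro h
        apply hP0
        rw [hP, h, map_empty]
      conv_lhs => rw [hP, map_some_map_optBlock, fmoment_liftFam blk Δ f H s hne]
      congr 2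
      funext φ
      rw [pobs, if_neg hn, mul_one]

omit [DecidableEq α] in
/-- [folklore] -/
private theorem weight_mul_source_eq (A : Matrix α α ℝ) (φ : α → ℝ) :
    weight A φ * source f φ = Real.exp (φ ⬝ᵥ f) * Real.exp (-(1/2 : ℝ) * (φ ⬝ᵥ A *ᵥ φ)) := by
  rw [B2Eq228Conditioning.weight, B2Eq228Conditioning.source, mul_comm]
  congr 2
  unfold dotProduct
  exact sum_congr rfl fun x _ => mul_comm _ _

variable (𝒞 : ((α → ℝ) → ℝ) → Prop)
  (hC : ∀ G, 𝒞 G → ContDiff ℝ 1 G ∧ (∃ K₀ : ℝ, ∀ φ, ‖G φ‖ ≤ K₀) ∧ ∃ K₁ : ℝ, ∀ φ, ‖fderiv ℝ G φ‖ ≤ K₁)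
  (hD : ∀ G (u : α → ℝ), 𝒞 G → 𝒞 (fun φ => fderiv ℝ G φ u)) {H} (hH : 𝒞 H) (z₀ : Finset I → α)

omit [DecidableEq α] [Fintype I] in
include hC hH in
/-- [folklore] -/
private theorem pobs_measurable_bdd (P : Finset (Option (Finset I))) :
    AEStronglyMeasurable (pobs H P) volume ∧ ∃ K : ℝ, ∀ φ, ‖pobs H P φ‖ ≤ K := by
  obtain ⟨hH1, ⟨K₀, hK₀⟩, -⟩ := hC H hH
  by_cases hn : none ∈ P
  · have : pobs H P = H := funext fun φ => if_pos hn
    rw [this]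
    exact ⟨hH1.continuous.aestronglyMeasurable, K₀, hK₀⟩
  · have : pobs H P = fun _ => (1:ℝ) := funext fun φ => if_neg hn
    rw [this]
    exact ⟨aestronglyMeasurable_const, 1, fun _ => by simp⟩

include hΔ hs hC hH in
/-- **The block-family moments are colour sums of two-leg moments**:
`fmoment s (P.map optBlock) = Σ_{z ∈ colourings of P} ⟨Π_{l∈legs P}⟨Φ,v_z(l)⟩ · H^{[none∈P]}⟩_s`.
[cite: BalabanImbrieJaffe1988, §5.13 p.305] -/
theorem fmoment_eq_sum_gmoment (P : Finset (Option (Finset I))) :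
    fmoment blk Δ f H s (P.map optBlock)
      = ∑ z ∈ Fintype.piFinset (colours (fun _ => (univ : Finset α)) z₀ P),
          gmoment (interpForm blk Δ s) f Leg.blk (lvec blk Δ s z) H P := by
  have hApd : (interpForm blk Δ s).PosDef := interpForm_posDef blk hΔ hs
  obtain ⟨hm, K, hK⟩ := pobs_measurable_bdd 𝒞 hC hH P
  rw [fmoment_map_optBlock blk hΔ hs f H P]
  simp only [gmoment, gexp, ← sum_div]
  congr 1
  have hobs : ∀ z, gobs Leg.blk (lvec blk Δ s z) H P = fun φ => (∏ l ∈ legs Leg.blk P, φ ⬝ᵥ lvec blk Δ s z l) * pobs H P φ :=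
    fun z => rfl
  simp only [hobs]
  rw [← integral_finsetSum]
  · refine integral_congr_ae (Filter.Eventually.of_forall fun φ => ?_)
    simp only
    rw [← sum_piFinset_prod_legs blk Δ s z₀ P φ, sum_mul, sum_mul]
  · intro z _
    have h := integrable_fieldProd_bdd_tilt hApd (legs Leg.blk P) (lvec blk Δ s z) f hm hK
    refine h.congr (Filter.Eventually.of_forall fun φ => ?_)
    simp only
    rw [weight_mul_source_eq]

end Moments

/-! ## §3  Truncation: sites × connected two-leg diagrams -/

section Main

variable {α I : Type} [Fintype α] [DecidableEq α] [Fintype I] [DecidableEq I] (blk : α → I)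
  {Δ : Matrix α α ℝ} (hΔ : Δ.PosDef) {c C : ℝ} (hc : 0 < c)
  (hcΔ : ∀ v, c * (v ⬝ᵥ v) ≤ v ⬝ᵥ (Δ *ᵥ v)) (hCΔ : ∀ v, v ⬝ᵥ (Δ *ᵥ v) ≤ C * (v ⬝ᵥ v))
  {s : I → ℝ} (hs : ∀ l, 0 ≤ s l ∧ s l ≤ 1) (f : α → ℝ)
  (𝒞 : ((α → ℝ) → ℝ) → Prop)
  (hC : ∀ G, 𝒞 G → ContDiff ℝ 1 G ∧ (∃ K₀ : ℝ, ∀ φ, ‖G φ‖ ≤ K₀) ∧ ∃ K₁ : ℝ, ∀ φ, ‖fderiv ℝ G φ‖ ≤ K₁)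
  (hD : ∀ G (u : α → ℝ), 𝒞 G → 𝒞 (fun φ => fderiv ℝ G φ u)) {H : (α → ℝ) → ℝ} (hH : 𝒞 H)
  (z₀ : Finset I → α)

include hΔ hs hC hD hH in
/-- **"EACH Φ CONTRACTS … IF A CLOSED LOOP FORMS, OR IF A TRAIN OF COVARIANCES BEGINNING AND ENDING IN ℱ FORMS, THEN THE
TERM DISAPPEARS WITH TRUNCATION"** for the objects of (5.13.3): the joint truncation of the block vertices `V_B`
(`B ∈ σ`) and `H` is the sum over the colourings `z` (one site per block) and over the CONNECTED complete contractions of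
the two-leg monomials with the observable,
`⟨[V_{B₁};]⋯[V_{B_k};]H⟩_s = Σ_z Σ_{g ∈ diags(σ ∪ {H}), connected} dval_z(g)`. [cite: BalabanImbrieJaffe1988, §5.13 p.306] -/
theorem ursell_fmoment_eq_sum_connected (σ : Finset (Finset I)) :
    ursellOf (fmoment blk Δ f H s) (insert {none} (liftFam σ))
      = ∑ z ∈ Fintype.piFinset (colours (fun _ => (univ : Finset α)) z₀ (insertNone σ)),
          ∑ g ∈ (diags Leg.blk (insertNone σ)).filter (IsConn Leg.blk (insertNone σ)),
            dval (gw (interpForm blk Δ s) f (lvec blk Δ s z)) (gω (interpForm blk Δ s) f (lvec blk Δ s z) H)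
              (insertNone σ) g := by
  have hApd : (interpForm blk Δ s).PosDef := interpForm_posDef blk hΔ hs
  have hV : (insertNone σ).Nonempty := ⟨none, none_mem_insertNone⟩
  rw [← map_optBlock_insertNone, ← ursellOf_map optBlock (fmoment blk Δ f H s) (insertNone σ),
    ursellOf_piFinset (fun _ => (univ : Finset α)) z₀ (fun P => fmoment blk Δ f H s (P.map optBlock))
      (fun z P => gmoment (interpForm blk Δ s) f Leg.blk (lvec blk Δ s z) H P) ?_ ?_ hV]
  · exact sum_congr rfl fun z _ =>
      ursellOf_gmoment (interpForm blk Δ s) f Leg.blk (lvec blk Δ s z) 𝒞 hC hD hH hApd hV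
  · -- locality: the two-leg moments of `P` see only the colours of the blocks of `P`
    intro P z z' hzz'
    have hg : gobs Leg.blk (lvec blk Δ s z) H P = gobs Leg.blk (lvec blk Δ s z') H P := by
      funext φ
      simp only [gobs]
      congr 1
      refine prod_congr rfl fun l hl => ?_
      have hb : z l.blk = z' l.blk := hzz' l.blk ((mem_legs Leg.blk).1 hl)
      simp only [lvec, hb]
    simp only [gmoment, hg]
  · exact fun P => fmoment_eq_sum_gmoment blk hΔ hs f 𝒞 hC hH z₀ P

include hΔ hc hcΔ hCΔ hs hC hD hH in
/-- **`∂/∂s_Γ⟨H⟩_s` AFTER THE COMPLETE INTEGRATION BY PARTS**: at every order,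
`∂Γ⟨H⟩(s) = Σ_{σ ∈ smallParts Γ} (−1)^{|σ|} Σ_z Σ_{g connected} dval_z(g)` — the corrected bracket form
(`dexp_eq_sum_smallParts`) with every field contracted to another field, to `H` or to ℱ, closed loops and ℱ–ℱ trains
gone.  (The regrouping of the connected two-leg diagrams into the trains of (5.13.3) is not done here.)
[cite: BalabanImbrieJaffe1988, §5.13 p.306] -/
theorem dexp_eq_sum_connected (Γ : Finset I) :
    dexp blk Δ f H Γ s
      = ∑ σ ∈ smallParts Γ, (-1 : ℝ) ^ σ.card *
          ∑ z ∈ Fintype.piFinset (colours (fun _ => (univ : Finset α)) z₀ (insertNone σ)),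
            ∑ g ∈ (diags Leg.blk (insertNone σ)).filter (IsConn Leg.blk (insertNone σ)),
              dval (gw (interpForm blk Δ s) f (lvec blk Δ s z)) (gω (interpForm blk Δ s) f (lvec blk Δ s z) H)
                (insertNone σ) g := by
  obtain ⟨hH1, ⟨K₀, hK₀⟩, -⟩ := hC H hH
  rw [dexp_eq_sum_smallParts blk hΔ hc hcΔ hCΔ hs f hH1.continuous.aestronglyMeasurable hK₀ Γ]
  exact sum_congr rfl fun σ _ => by rw [ursell_fmoment_eq_sum_connected blk hΔ hs f 𝒞 hC hD hH z₀ σ]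

end Main

end Literature.MathematicalPhysics.QuantumFieldTheory.BalabanImbrieJaffe1984to88.BIJ88TruncationConnected5133
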